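import Summits.PneNP.PneNP.Theses.SzkEntropy
import Summits.PneNP.PneNP.Theorems.SzkEntropyPeaThreeNotInP
import Summits.PneNP.PneNP.Theorems.SzkEntropyPeaThreeNotInPKillSwitch
import Summits.PneNP.PneNP.Theorems.SzkEntropyCookModelBridge
import Summits.PneNP.PneNP.Theorems.SzkEntropyPhCollapse
import Literature.Computability.Complexity.PolynomialEntropyApproximation
import Literature.Computability.Complexity.PromiseZPPProofs

/-!
# PneNP / SzkEntropy — crux `PeaTwoMemBPP` (stmt-PneNP-10778), negative side: a disproof would prove the thesis

Route `PneNP/SzkEntropy`, crux item stmt-PneNP-10778 (`PeaTwoMemBPP`, rank 4, filed "open both ways"):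

  `PEA 2 ∈ PromiseBPP'` — entropy approximation with additive gap 1 for QUADRATIC maps over `F₂`
  is in textbook promise-BPP.

This file is the LOAD-BEARING ANALYSIS of the standing disprover (`Cruxes/PeaTwoMemBPP/Disproof.lean`,
§1–§3).  The crux has no hypotheses to drop; instead we prove what its NEGATION entails:

* `PEA_mem_PromiseBPP'_of_le` / `szkEntropy_not_peaTwoMemBPP_imp_not_peaThreeMemBPP` — the route's
  kill switch `PeaThreeMemBPP` (`PEA 3 ∈ PromiseBPP'`) implies the crux (promise-BPP is antitone in the
  promise and the instance sets of `PEA_d` grow with `d`);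
* `szkEntropy_not_peaTwoMemBPP_imp_peaThreeNotInP` — `¬ PeaTwoMemBPP → PeaThreeNotInP`: refuting the
  crux proves the route's thesis X (`PEA 3 ∉ PromiseP`), through the PROVED tree inclusion
  `PromiseP ⊆ PromiseBPP'` (`PromiseZPPProofs.lean`) and degree monotonicity
  (`SzkEntropyPeaThreeNotInP.lean`);
* `szkEntropy_not_peaTwoMemBPP_closes` — hence `¬ PeaTwoMemBPP → PeaMemPH → PhCollapse →
  CookModelBridge → PneNP` by the route's certified deciding theorem `closes`, and, feeding the two
  supports already PROVED in the tree (`cookModelBridge_proof`, `szkEntropy_phCollapse_proof`),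
  `szkEntropy_not_peaTwoMemBPP_imp_pneNP_of_peaMemPH : ¬ PeaTwoMemBPP → PeaMemPH → PneNP`: a disproof of
  the crux is an unconditional randomized lower bound that settles the summit given ONE support known in
  print (`PeaMemPH`: `PEA_d ∈ promise-PH`, SZK ⊆ AM ∩ coAM).

So the crux cannot be refuted short of proving `P ≠ NP`; the disprover's remaining surface is the
ALGORITHMIC heuristics behind it (census / Rényi), handled in the sibling Negative files.

References: Z. Dvir, D. Gutfreund, G. N. Rothblum, S. Vadhan, *On approximating the entropy of
polynomial mappings*, ICS 2011 (ECCC TR10-160), §3 and Thm 1.1; O. Goldreich, *On promise problems*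
(2006), Def. 1.2 and §1.2.
-/

namespace Summit.PneNP.PneNP.Theorems

open Literature.Computability.Complexity
open Summit.PneNP.PneNP.Theses.SzkEntropy

/-- **The crux is the library's `PEA 2 ∈ PromiseBPP'`.** The inline `let ev/H/PEA := …` spelling of
`PeaTwoMemBPP` unfolds definitionally to the statement about
`Literature.Computability.Complexity.PEA 2`. [DvirGutfreundRothblumVadhan2010, §3 p. 6] -/
theorem szkEntropy_peaTwoMemBPP_iff : PeaTwoMemBPP ↔ PEA 2 ∈ PromiseBPP' :=
  Iff.rfl

/-- Textbook promise-BPP is antitone in the promise: shrinking the yes- and no-sets keeps membership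
(same witness language in `P`, same coin polynomial).  Local copy of the Cryptography-cone lemma
`mem_PromiseBPP'_of_subset` (`LatticeOWF.lean`), kept private to avoid that import.
[Goldreich2006, §1.2 (Def. 2)] -/
private theorem mem_PromiseBPP'_anti {Q Q' : PromiseProblem} (hy : Q.yes ≤ Q'.yes)
    (hn : Q.no ≤ Q'.no) (h : Q' ∈ PromiseBPP') : Q ∈ PromiseBPP' := by
  obtain ⟨L', hL', p, hyes, hno⟩ := h
  exact ⟨L', hL', p, fun x hx => hyes x (hy hx), fun x hx => hno x (hn hx)⟩

/-- **Promise-BPP membership of `PEA_d` is antitone in the degree bound**: `PEA d' ∈ PromiseBPP'` and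
`d ≤ d'` give `PEA d ∈ PromiseBPP'` (`PEA_yes_mono`, `PEA_no_mono`: the instance sets grow with `d`,
and the same randomized decider works on the smaller promise).
[DvirGutfreundRothblumVadhan2010, §3 p. 6; Goldreich2006, §1.2] -/
theorem PEA_mem_PromiseBPP'_of_le {d d' : ℕ} (h : d ≤ d') (hd' : PEA d' ∈ PromiseBPP') :
    PEA d ∈ PromiseBPP' :=
  mem_PromiseBPP'_anti (PEA_yes_mono h) (PEA_no_mono h) hd'

/-- `¬ PeaTwoMemBPP → PEA 2 ∉ PromiseP`, by the proved inclusion `PromiseP ⊆ PromiseBPP'`.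
[Gill1977, Prop. 5.1; Goldreich2006, §1.2] -/
theorem szkEntropy_not_peaTwoMemBPP_imp_PEA_two_not_mem_PromiseP (h : ¬ PeaTwoMemBPP) :
    PEA 2 ∉ PromiseP :=
  fun h2 => h (szkEntropy_peaTwoMemBPP_iff.2 (PromiseP_subset_PromiseBPP' h2))

/-- **A disproof of the crux proves the route's thesis X**: `¬ PeaTwoMemBPP → PeaThreeNotInP`
(`PEA 3 ∉ PromiseP`, by degree monotonicity `szkEntropy_peaThreeNotInP_of_le`).
[DvirGutfreundRothblumVadhan2010, §3 p. 6 and Thm 1.1] -/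
theorem szkEntropy_not_peaTwoMemBPP_imp_peaThreeNotInP (h : ¬ PeaTwoMemBPP) : PeaThreeNotInP :=
  szkEntropy_peaThreeNotInP_of_le (d := 2) (by norm_num)
    (szkEntropy_not_peaTwoMemBPP_imp_PEA_two_not_mem_PromiseP h)

/-- **A disproof of the crux refutes the kill switch**: `¬ PeaTwoMemBPP → ¬ PeaThreeMemBPP`
(equivalently, the kill switch `PEA 3 ∈ PromiseBPP'` implies the crux: a randomized algorithm for
cubic maps is one for quadratic maps, `PEA_mem_PromiseBPP'_of_le`).
[DvirGutfreundRothblumVadhan2010, §3 p. 6] -/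
theorem szkEntropy_not_peaTwoMemBPP_imp_not_peaThreeMemBPP (h : ¬ PeaTwoMemBPP) : ¬ PeaThreeMemBPP :=
  fun h3 => h (szkEntropy_peaTwoMemBPP_iff.2
    (PEA_mem_PromiseBPP'_of_le (by norm_num) (szkEntropy_peaThreeMemBPP_iff.1 h3)))

/-- **A disproof of the crux proves the summit, given the three provable-now supports of the route**
(`PeaMemPH`, `PhCollapse`, `CookModelBridge`), through the certified deciding theorem `closes`.
Consequently no refutation of `PeaTwoMemBPP` is available short of `P ≠ NP`.
[DvirGutfreundRothblumVadhan2010, Thm 1.1; AroraBarakCC2009, Thm 5.4] -/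
theorem szkEntropy_not_peaTwoMemBPP_closes (h : ¬ PeaTwoMemBPP) (hPH : PeaMemPH) (hC : PhCollapse)
    (hB : CookModelBridge) : _root_.PneNP :=
  closes (szkEntropy_not_peaTwoMemBPP_imp_peaThreeNotInP h) hPH hC hB

/-- **A disproof of the crux plus the one printed support `PeaMemPH` proves the summit**:
`¬ PeaTwoMemBPP → PeaMemPH → PneNP`, the supports `PhCollapse` and `CookModelBridge` being PROVED tree
theorems (`szkEntropy_phCollapse_proof`, `cookModelBridge_proof`).  (`PeaMemPH`, `PEA_d ∈ promiseLift PH`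
for all `d`, is known in print: Stockmeyer counting + Lautemann, or SZK ⊆ AM ∩ coAM ⊆ Π₂.)
[DvirGutfreundRothblumVadhan2010, Thm 1.1 and Lemma 4.9; AroraBarakCC2009, Thm 5.4] -/
theorem szkEntropy_not_peaTwoMemBPP_imp_pneNP_of_peaMemPH (h : ¬ PeaTwoMemBPP) (hPH : PeaMemPH) :
    _root_.PneNP :=
  szkEntropy_not_peaTwoMemBPP_closes h hPH szkEntropy_phCollapse_proof cookModelBridge_proof

end Summit.PneNP.PneNP.Theorems
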